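import Summits.CriticalPhenomena.CardyFormulaZ2.Theorems.CardyComplexConeCoherentMoreraKirchhoffCycleWinding
import Literature.Probability.LatticeModels.InnerFacesHoleFree

/-!
# Boundary vertices are outside every cycle of inner corners (Jordan carriers)
(helper for stub `stub_kirchhoff` of line `finitary-green-pairing`, crux `CoherentMorera`, stmt-CriticalPhenomena-11388)

Let `E` be discrete Dobrushin data whose domain is the carrier of a Jordan domain and let `L` be a cycle
of `nextCorner β` all of whose corners have INNER faces.  Then every vertex `a` cornering a NON-inner
face `b` (for instance the start vertex of the exploration, next to the outer face across `e_a`) has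
winding number `0` with respect to the closed perturbed polygon of `L` (`wind_eq_zero_of_corner_not_inner`):
the half-diagonal from `a` into `b` misses the polygon (its dart pieces lie in inner faces, its
connectors miss half-diagonals), the centre of `b` can be pushed through side-adjacent NON-inner faces to
arbitrary height (`holeFree_innerFaces`, a consequence of the Jordan curve theorem proved in the tree)
along centre segments missing the polygon (`wind_faceCenter_eq_of_faceStep`), and a face above the whole
polygon has winding number `0`.  This is where the simple connectivity of Dobrushin domains enters the
vertex relation of Duminil-Copin 2012, Prop. 4 at spin `1/3` (the annulus with marks on the hole is a
counterexample to the unrestricted relation: refuted-misstated item stmt-CriticalPhenomena-11306).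
-/

noncomputable section

namespace Summit.CriticalPhenomena.CardyFormulaZ2.Cruxes.CoherentMorera.FinitaryGreenPairing

open Complex Set Literature.Topology.PlaneTopology Literature.Probability.LatticeModels
open Literature.Probability.Percolation (BondConfig)

variable {β : BondConfig (Site 2)} {q : Site 2 × Fin 4} {E : DiscreteDobrushin}

/-- A face is determined by its two coordinates. -/
theorem site_eq_of_coords {f g : Site 2} {I J : Fin 2} (hJI : J ≠ I) (hI : f I = g I) (hJ : f J = g J) :
    f = g := by
  funext i
  rcases fin_two_eq_other hJI with ⟨rfl, rfl⟩ | ⟨rfl, rfl⟩ <;> fin_cases i <;> assumption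

/-- **Centre segments between adjacent NON-inner faces miss the perturbed polygon of a cycle of inner
corners**: dart pieces never meet centre segments; vertex connectors never do; a face connector meets
the centre segment of `f'`, `g'` only if its own (inner) face is one of them. -/
theorem not_mem_range_cyLoop_of_mem_centerSeg {n : ℕ} (hP : cornerOrbit β q (n + 1) = q)
    (hinner : ∀ m, E.IsInnerFace (cFace (cornerOrbit β q m))) {g g' : Site 2}
    (hs : FaceStep {f : Site 2 | E.IsInnerFace f} g g') {z : ℂ} (hz : z ∈ centerSeg g g') :
    z ∉ range (cyLoop n hP) := by
  refine not_mem_range_cyLoop hP (fun j _ hzj => ?_) (fun j _ hzj => ?_)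
  · rw [cyDart_eq] at hzj
    exact dartSeg_inter_centerSeg (isCorner_cy j) hs.1 hzj hz
  · rcases cyConn_cases j hzj with ⟨I, J, -, -, -, -, -, -, hshape⟩ | ⟨I, J, hJI, -, hshape⟩
    · exact hshape.not_mem_centerSeg hs.1 hz
    · -- the face connector: its face `cyF j` is inner, `g`, `g'` are not
      have hface : E.IsInnerFace (cyF β q j) := hinner j
      rcases hshape.2.2 with h18 | h78
      · obtain ⟨hf, hg, hJ⟩ := hshape.centerSeg_faces (L := cyF β q j J) (fun _ => rfl)
          (fun h => by rw [h18] at h; linarith) hs.1 hz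
        rcases hJ with ⟨-, hL⟩ | ⟨-, hL⟩
        · exact hs.2.2 (by rw [Set.mem_setOf_eq, ← site_eq_of_coords hJI hg.symm hL]; exact hface)
        · exact hs.2.1 (by rw [Set.mem_setOf_eq, ← site_eq_of_coords hJI hf.symm hL]; exact hface)
      · obtain ⟨hf, hg, hJ⟩ := hshape.centerSeg_faces (L := cyF β q j J + 1)
          (fun h => by rw [h78] at h; linarith) (fun _ => rfl) hs.1 hz
        rcases hJ with ⟨h1, hL⟩ | ⟨h1, hL⟩
        · exact hs.2.1 (by
            rw [Set.mem_setOf_eq, ← site_eq_of_coords hJI hf.symm (by omega)]; exact hface)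
        · exact hs.2.2 (by
            rw [Set.mem_setOf_eq, ← site_eq_of_coords hJI hg.symm (by omega)]; exact hface)

/-- **The winding number of the centres is constant along a face step between non-inner faces.** -/
theorem wind_faceCenter_eq_of_faceStep {n : ℕ} (hP : cornerOrbit β q (n + 1) = q)
    (hinner : ∀ m, E.IsInnerFace (cFace (cornerOrbit β q m))) {g g' : Site 2}
    (hs : FaceStep {f : Site 2 | E.IsInnerFace f} g g') :
    wind (fun t => (cyLoop n hP).extend t - faceCenter g) = wind (fun t => (cyLoop n hP).extend t - faceCenter g') :=
  wind_cyLoop_eq_of_segment hP fun _ hz => not_mem_range_cyLoop_of_mem_centerSeg hP hinner hs hz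

/-- The same along a chain of face steps. -/
theorem wind_faceCenter_eq_of_reflTransGen {n : ℕ} (hP : cornerOrbit β q (n + 1) = q)
    (hinner : ∀ m, E.IsInnerFace (cFace (cornerOrbit β q m))) {g g' : Site 2}
    (hs : Relation.ReflTransGen (FaceStep {f : Site 2 | E.IsInnerFace f}) g g') :
    wind (fun t => (cyLoop n hP).extend t - faceCenter g) = wind (fun t => (cyLoop n hP).extend t - faceCenter g') := by
  induction hs with
  | refl => rfl
  | tail _ hst ih => exact ih.trans (wind_faceCenter_eq_of_faceStep hP hinner hst)

/-- **A face above the whole polygon has winding number zero.** There is a height `M` such that every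
face `g` with `g 1 ≥ M` has `wind = 0` at its centre. -/
theorem exists_height_wind_faceCenter_eq_zero {n : ℕ} (hP : cornerOrbit β q (n + 1) = q) :
    ∃ M : ℤ, ∀ g : Site 2, M ≤ g 1 → wind (fun t => (cyLoop n hP).extend t - faceCenter g) = 0 := by
  set Y : ℝ := 1 + ∑ j ∈ Finset.range (n + 2), (|(cyS β q j).im| + |(cyT β q j).im|) with hY
  have hterm : ∀ j ≤ n + 1, |(cyS β q j).im| + |(cyT β q j).im| ≤
      ∑ j ∈ Finset.range (n + 2), (|(cyS β q j).im| + |(cyT β q j).im|) := fun j hj =>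
    Finset.single_le_sum (f := fun j => |(cyS β q j).im| + |(cyT β q j).im|)
      (fun i _ => add_nonneg (abs_nonneg _) (abs_nonneg _)) (Finset.mem_range.2 (by omega))
  have hS : ∀ j ≤ n + 1, (cyS β q j).im < Y := fun j hj => by
    have := hterm j hj; have := le_abs_self (cyS β q j).im; have := abs_nonneg (cyT β q j).im
    rw [hY]; linarith
  have hT : ∀ j ≤ n, (cyT β q j).im < Y := fun j hj => by
    have := hterm j (by omega); have := le_abs_self (cyT β q j).im; have := abs_nonneg (cyS β q j).im
    rw [hY]; linarith
  refine ⟨⌈Y⌉, fun g hg => wind_cyLoop_eq_zero_of_im_ne hP fun z hz => ?_⟩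
  have hlt := im_lt_of_mem_range_cyLoop hP hS hT hz
  have hc : (faceCenter g).im = g 1 + 1 / 2 := by rw [faceCenter_eq]
  have hg' : (Y : ℝ) ≤ g 1 := (Int.le_ceil Y).trans (by exact_mod_cast hg)
  rw [hc]; linarith

/-- **Boundary vertices are outside every cycle of inner corners.** For discrete Dobrushin data on
(the carrier of) a Jordan domain and a cycle of `nextCorner β` whose corners all have inner faces, a
vertex `a` cornering a non-inner face `faceAt a k` has winding number `0` with respect to the closed
perturbed polygon of the cycle. -/
theorem wind_eq_zero_of_corner_not_inner (D : Literature.Probability.RandomPlanarGeometry.JordanDomain)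
    (hΩ : E.Ω = D.carrier) (hδ : 0 < E.δ) {n : ℕ} (hP : cornerOrbit β q (n + 1) = q)
    (hinner : ∀ m, E.IsInnerFace (cFace (cornerOrbit β q m))) {a : Site 2} {k : Fin 4}
    (hout : ¬ E.IsInnerFace (faceAt a k)) :
    wind (fun t => (cyLoop n hP).extend t - Site.toComplex a) = 0 := by
  -- (1) along the half-diagonal from `a` into the non-inner face `faceAt a k`
  have h1 : wind (fun t => (cyLoop n hP).extend t - Site.toComplex a) =
      wind (fun t => (cyLoop n hP).extend t - faceCenter (faceAt a k)) := by
    refine wind_cyLoop_eq_of_segment hP fun z hz => not_mem_range_cyLoop hP (fun j _ hzj => ?_) (fun j _ hzj => ?_)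
    · have hj := cy_eq_of_mem_halfDiag j hzj (show z ∈ halfDiag a (faceAt a k) from hz)
      apply hout
      have : cFace (cornerOrbit β q j) = faceAt a k := by rw [hj]; rfl
      rw [← this]; exact hinner j
    · exact cyConn_disjoint_halfDiag j (isCorner_faceAt a k) hzj hz
  -- (2) push the face up through non-inner faces (hole-freeness of the inner faces)
  obtain ⟨M, hM⟩ := exists_height_wind_faceCenter_eq_zero (β := β) (q := q) hP
  obtain ⟨g', hg', hchain⟩ := holeFree_innerFaces D hΩ hδ (faceAt a k) hout M
  rw [h1, wind_faceCenter_eq_of_reflTransGen hP hinner hchain]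
  exact hM g' hg'

/-- **Boundary vertices are outside every cycle of inner corners, registered form** (glue sub-goal
`boundaryOutside_wind_zero` of the line). -/
theorem boundaryOutside_wind_zero : ∀ (D : Literature.Probability.RandomPlanarGeometry.JordanDomain)
    (E : DiscreteDobrushin), E.Ω = D.carrier → 0 < E.δ →
    ∀ (β : BondConfig (Site 2)) (q : Site 2 × Fin 4) (n : ℕ) (hP : cornerOrbit β q (n + 1) = q),
    (∀ m, E.IsInnerFace (cFace (cornerOrbit β q m))) → ∀ (a : Site 2) (k : Fin 4),
    ¬ E.IsInnerFace (faceAt a k) → wind (fun t => (cyLoop n hP).extend t - Site.toComplex a) = 0 :=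
  fun D _ hΩ hδ _ _ _ hP hinner _ _ hout => wind_eq_zero_of_corner_not_inner D hΩ hδ hP hinner hout

end Summit.CriticalPhenomena.CardyFormulaZ2.Cruxes.CoherentMorera.FinitaryGreenPairing

end
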